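import Literature.AnabelianGeometry.EtaleTheta.Discharge.Sec2Rmk2141AlphaDeltaNoExtension
import Literature.AnabelianGeometry.EtaleTheta.SettingModelTateGroupLevel
import HarnessLib

/-!
# [EtTh] Remark 2.14.1, AUTOMORPHISM READING: an automorphism of `Π^tp_X̲̲[μ_N]` extending the shift `α_δ` of
# `Π^tp_Y̲̲[μ_N]` IS a cocycle shift (centraliser of `Π^tp_Y̲̲` trivial) — hence the NO-GO at the Tate datum of record in
# print's literal reading (proof-only companion; row «RMK2141-NOGO@modelχq», part 2c)

S. Mochizuki, *The Étale Theta Function and its Frobenioid-theoretic Manifestations* [EtTh], Publ. RIMS **45**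
(2009), §2 Remark 2.14.1, PRIMS PDF p. 51 (printed p. 277): "although the automorphism `α̈_δ` extends to an
automorphism `α_δ` of `Π^tp_Y[μ_N]`, the automorphism `α_δ` fails to extend to `Π^tp_X[μ_N]`" (locators `p.N` = PDF
pages; bib key `MochizukiEtTh2009`) [cite: MochizukiEtTh2009, Rmk 2.14.1 p.51].  Cell `abc-iut`, layer L2 [EtTh],
seat abc-iut-L2-d1 (gen 9), row «RMK2141-NOGO@modelχq» (abc-iut-L2-lead R1137 / R1158 (4) / R1180 / R1248), part 2c.
PROOF-ONLY companion (no definition / instance / notation / new named fact) over abc-iut-L2-t2's `MonoThetaEnv`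
(`ThetaEnvData`, `env = Π^tp_Y[μ_N]`, `CycEnvelope`, `shift`), this seat's part 2b `Sec2Rmk2141AlphaDeltaNoExtension`
(p506073: the COCYCLE-SHIFT reading at the datum) and abc-iut-w5-d249 / abc-iut-L4's slimness of the stage-2 model
`isSlimGroup_PiTpχq` (`SettingModelTateGroupLevel`).  Everything consumed BY NAME.

READING.  Part 2b (and abc-iut-w6-d076's engine p500356) type «`α_δ` extends to `Π^tp_X[μ_N]`» in the COCYCLE
currency of the typed Prop. 2.14 (ii): a cocycle `ε` of `Π^tp_X̲̲` restricting to `δ`, whose shift `α_ε` extends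
`α_δ`.  Print's sentence is about AUTOMORPHISMS; the engine file records that the automorphism reading "additionally
involves the centraliser of `Π^tp_Y[μ_N]` in `Π^tp_X[μ_N]`".  This file types exactly that and discharges it:
* `ThetaEnvData.exists_cocycle_extension_of_aut_extension` — GENERIC over any `T : ThetaEnvData N`: if the
  centraliser of `Π^tp_Y̲̲` in `Π^tp_X̲̲` is trivial, then EVERY `β ∈ Aut(μ_N ⋊ Π^tp_X̲̲)` (`CycEnvelope T.aug T.chi`)
  agreeing with `shift hδ` on the image of `Π^tp_Y̲̲[μ_N] = T.env` (`ι(m, y) = (m, y)`) is a cocycle shift: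
  `ε(g) := β(1, g).left` is an `aug`-cocycle with `ε|_{Π^tp_Y̲̲} = δ` (the endomorphism `proj ∘ β ∘ inr` of `Π^tp_X̲̲`
  restricts to the identity of the normal subgroup `Π^tp_Y̲̲`, so `g⁻¹·β̄(g)` centralises `Π^tp_Y̲̲` and `β̄ = id`;
  pure group algebra, no topology);
* `SettingModel.centralizer_PiY_trivial_modelTate` — at the Tate datum of record, for EVERY `X̲̲`-choice `C`, the
  centraliser of `Π^tp_Y̲̲ = Ker(toZ) ∩ Π^tp_X̲̲` in `Π^tp_X̲̲` is trivial (it is OPEN in the SLIM `Π^tp_X(modelχq)`);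
* **`SettingModel.not_exists_aut_extension_alphaDelta_modelTate`** — under the hypotheses of part 2b's
  `not_exists_extension_alphaDelta_modelTate` (`N ∤ 2`, `gcd(N, l) = 1`, `x = σ₀^l`, `α_δ ∘ s^Θ_η = x·s^Θ_η`) there is
  NO automorphism `β` of `Π^tp_X̲̲[μ_N]` with `β ∘ ι = ι ∘ α_δ` on `Π^tp_Y̲̲[μ_N]`.
HONEST FRAMING: `modelχq` is a SEMI-SYNTHETIC model of the typed §1 interface — a NO-GO at OUR datum in both readings,
not a claim beyond print's own remark; nothing of [EtTh] (refereed) is endorsed or disputed; no side is taken on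
[IUTchIII] Cor. 3.12; typed ≠ proved elsewhere.
-/

noncomputable section

namespace Literature.AnabelianGeometry.EtaleTheta

namespace ThetaEnvData

universe u

variable {N : ℕ+} (T : ThetaEnvData.{u} N)

/-- **An automorphism of `Π^tp_X[μ_N]` extending a shift of `Π^tp_Y[μ_N]` is itself a shift**, provided the
centraliser of `Π^tp_Y` in `Π^tp_X` is trivial: if `β ∈ Aut(μ_N ⋊ Π^tp_X)` agrees on the image of
`Π^tp_Y[μ_N] = μ_N ⋊ Π^tp_Y` with the shift `α_δ` by a cocycle `δ` of `Π^tp_Y`, then `β(m, g) = (m·ε(g), g)` for an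
`aug`-cocycle `ε` of `Π^tp_X` with `ε|_{Π^tp_Y} = δ` (`β` fixes `μ_N` because `α_δ` does; `proj ∘ β ∘ inr` is an
endomorphism of `Π^tp_X` restricting to the identity of the normal subgroup `Π^tp_Y`, so `g⁻¹·β̄(g)` centralises
`Π^tp_Y`).  This reduces the "automorphism" reading of Remark 2.14.1 to the cocycle-shift reading.
[cite: MochizukiEtTh2009, Rmk 2.14.1 p.51] -/
theorem exists_cocycle_extension_of_aut_extension
    (hZ : ∀ g : T.PiX, (∀ y : T.PiY, g * (y : T.PiX) = (y : T.PiX) * g) → g = 1)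
    {δ : T.PiY → T.mu} (hδ : CycEnvelope.IsEnvCocycle T.augY T.chi δ)
    (β : MulAut (CycEnvelope T.aug T.chi))
    (hβ : ∀ z : T.env, β ⟨z.left, (z.right : T.PiX)⟩ =
      ⟨(CycEnvelope.shift hδ z).left, ((CycEnvelope.shift hδ z).right : T.PiX)⟩) :
    ∃ ε : T.PiX → T.mu, CycEnvelope.IsEnvCocycle T.aug T.chi ε ∧ ∀ y : T.PiY, ε y = δ y := by
  -- the induced endomorphism `β̄ = proj ∘ β ∘ inr` of `Π^tp_X` is the identity
  let βbar : T.PiX →* T.PiX :=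
    SemidirectProduct.rightHom.comp (β.toMonoidHom.comp SemidirectProduct.inr)
  have hβbar : ∀ g : T.PiX, βbar g = (β ⟨1, g⟩).right := fun g => rfl
  have hY : ∀ y : T.PiY, β ⟨1, (y : T.PiX)⟩ = ⟨δ y, (y : T.PiX)⟩ := by
    intro y
    have h := hβ ⟨1, y⟩
    change β ⟨1, (y : T.PiX)⟩ = ⟨1 * δ y, ((y : T.PiY) : T.PiX)⟩ at h
    rw [one_mul] at h
    exact h
  have hβbarY : ∀ y : T.PiY, βbar (y : T.PiX) = y := by
    intro y
    rw [hβbar, hY]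
  have hβbar_id : ∀ g : T.PiX, βbar g = g := by
    intro g
    have hc : g⁻¹ * βbar g = 1 := by
      refine hZ _ fun y => ?_
      have hy' : g * (y : T.PiX) * g⁻¹ ∈ T.PiY := T.PiY_normal.conj_mem _ y.2 g
      have h1 : βbar (g * (y : T.PiX) * g⁻¹) = g * (y : T.PiX) * g⁻¹ := hβbarY ⟨_, hy'⟩
      rw [map_mul, map_mul, map_inv, hβbarY] at h1
      -- `h1 : β̄ g * y * (β̄ g)⁻¹ = g * y * g⁻¹`
      calc g⁻¹ * βbar g * (y : T.PiX)
          = g⁻¹ * (βbar g * (y : T.PiX) * (βbar g)⁻¹) * βbar g := by group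
        _ = g⁻¹ * (g * (y : T.PiX) * g⁻¹) * βbar g := by rw [h1]
        _ = (y : T.PiX) * (g⁻¹ * βbar g) := by group
    calc βbar g = g * (g⁻¹ * βbar g) := by group
      _ = g := by rw [hc, mul_one]
  have hR : ∀ g : T.PiX, (β ⟨1, g⟩).right = g := fun g => (hβbar g).symm.trans (hβbar_id g)
  -- `ε(g) := β(1, g).left` is an `aug`-cocycle extending `δ`
  refine ⟨fun g => (β ⟨1, g⟩).left, fun g g' => ?_, fun y => ?_⟩
  · have hprod : (⟨1, g * g'⟩ : CycEnvelope T.aug T.chi) = ⟨1, g⟩ * ⟨1, g'⟩ := by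
      ext <;> simp
    have hh := congrArg SemidirectProduct.left
      (show β ⟨1, g * g'⟩ = β ⟨1, g⟩ * β ⟨1, g'⟩ by rw [← map_mul, ← hprod])
    rw [SemidirectProduct.mul_left, hR g] at hh
    exact hh
  · show (β ⟨1, (y : T.PiX)⟩).left = δ y
    rw [hY]

end ThetaEnvData

namespace SettingModel

open Literature.AnabelianGeometry.SemiGraphs _root_.Topology _root_.Function

variable (p : ℕ) [Fact p.Prime]
variable {l : ℕ} (C : (etaleThetaDataχqInr p).DoubleUnderline l) {N : ℕ+}
  (μ : (ThetaSetting.modelχq p 1 2 even_two).CyclotomeMod l N)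

/-- **The centraliser of `Π^tp_Y̲̲` in `Π^tp_X̲̲` is trivial at the Tate datum** (every `X̲̲`-choice): `Π^tp_Y̲̲ =
Ker(toZ) ∩ Π^tp_X̲̲` is open in the SLIM group `Π^tp_X(modelχq)` (`isSlimGroup_PiTpχq`: `Γ` slim, `G_{ℚ_p}` slim).
[cite: MochizukiEtTh2009, Rmk 2.14.1 p.51] -/
theorem centralizer_PiY_trivial_modelTate
    (g : (C.thetaEnvData μ (compat_modelχq p 1 2 even_two) (ThetaSetting.modelχq_sec2Hyps p 1 2 even_two)).PiX)
    (hg : ∀ y : (C.thetaEnvData μ (compat_modelχq p 1 2 even_two)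
        (ThetaSetting.modelχq_sec2Hyps p 1 2 even_two)).PiY,
      g * (y : (C.thetaEnvData μ (compat_modelχq p 1 2 even_two)
        (ThetaSetting.modelχq_sec2Hyps p 1 2 even_two)).PiX) = y * g) :
    g = 1 := by
  have hopen : IsOpen (((ThetaSetting.modelχq p 1 2 even_two).GtpY ⊓ C.Huu :
      Subgroup (ThetaSetting.modelχq p 1 2 even_two).PiTemp) : Set (ThetaSetting.modelχq p 1 2 even_two).PiTemp) :=
    (ThetaSetting.modelχq p 1 2 even_two).isOpen_ker_toZ.inter C.isOpen_Huu
  have hc := (isSlimGroup_PiTpχq p 1 2).centralizer_eq_bot _ hopen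
  have hmem : ((g : C.Huu) : (ThetaSetting.modelχq p 1 2 even_two).PiTemp) ∈
      Subgroup.centralizer (((ThetaSetting.modelχq p 1 2 even_two).GtpY ⊓ C.Huu :
        Subgroup (ThetaSetting.modelχq p 1 2 even_two).PiTemp) : Set (ThetaSetting.modelχq p 1 2 even_two).PiTemp) := by
    rw [Subgroup.mem_centralizer_iff]
    intro y hy
    have h := hg ⟨⟨y, (Subgroup.mem_inf.1 hy).2⟩, Subgroup.mem_subgroupOf.2 (Subgroup.mem_inf.1 hy).1⟩
    have h' := congrArg (fun t : C.Huu => (t : (ThetaSetting.modelχq p 1 2 even_two).PiTemp)) h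
    simpa using h'.symm
  rw [hc, Subgroup.mem_bot] at hmem
  exact Subtype.ext hmem

/-- **[EtTh] Remark 2.14.1 at the Tate datum of record, AUTOMORPHISM READING**: under the hypotheses of
`not_exists_extension_alphaDelta_modelTate` (`N ∤ 2`, `gcd(N, l) = 1`, `x = σ₀^l`, `α_δ ∘ s^Θ_η = x·s^Θ_η`), there is NO
automorphism `β` of `Π^tp_X̲̲[μ_N] = μ_N ⋊ Π^tp_X̲̲` extending `α_δ` along `Π^tp_Y̲̲[μ_N] ↪ Π^tp_X̲̲[μ_N]` — print's literal
"the automorphism `α_δ` fails to extend to `Π^tp_X[μ_N]`" (p. 51), at OUR semi-synthetic datum: such a `β` would be a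
cocycle shift (`exists_cocycle_extension_of_aut_extension`, centraliser clause by slimness of the model), excluded by
`not_exists_extension_alphaDelta_modelTate`. [cite: MochizukiEtTh2009, Rmk 2.14.1 p.51] -/
theorem not_exists_aut_extension_alphaDelta_modelTate (hN2 : ¬ (N : ℕ) ∣ 2) (hNl : Nat.Coprime N l)
    (x : C.Huu)
    (hx : (x : (ThetaSetting.modelχq p 1 2 even_two).PiTemp) =
      (SemidirectProduct.inl (gfpOf (FreeGroup.of 0)) : PiTpχq p 1 2) ^ l)
    {η : (C.thetaEnvData μ (compat_modelχq p 1 2 even_two)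
        (ThetaSetting.modelχq_sec2Hyps p 1 2 even_two)).PiYdd →
      (C.thetaEnvData μ (compat_modelχq p 1 2 even_two) (ThetaSetting.modelχq_sec2Hyps p 1 2 even_two)).mu}
    (hη : η ∈ (C.thetaEnvData μ (compat_modelχq p 1 2 even_two)
      (ThetaSetting.modelχq_sec2Hyps p 1 2 even_two)).thetaCocycles)
    {δ : (C.thetaEnvData μ (compat_modelχq p 1 2 even_two)
        (ThetaSetting.modelχq_sec2Hyps p 1 2 even_two)).PiY →
      (C.thetaEnvData μ (compat_modelχq p 1 2 even_two) (ThetaSetting.modelχq_sec2Hyps p 1 2 even_two)).mu}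
    (hδ : CycEnvelope.IsEnvCocycle
      (C.thetaEnvData μ (compat_modelχq p 1 2 even_two) (ThetaSetting.modelχq_sec2Hyps p 1 2 even_two)).augY
      (C.thetaEnvData μ (compat_modelχq p 1 2 even_two) (ThetaSetting.modelχq_sec2Hyps p 1 2 even_two)).chi δ)
    (hshift : ∀ g, CycEnvelope.shift hδ
        ((C.thetaEnvData μ (compat_modelχq p 1 2 even_two)
          (ThetaSetting.modelχq_sec2Hyps p 1 2 even_two)).sTheta hη g) =
      (C.thetaEnvData μ (compat_modelχq p 1 2 even_two) (ThetaSetting.modelχq_sec2Hyps p 1 2 even_two)).conjX x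
        ((C.thetaEnvData μ (compat_modelχq p 1 2 even_two)
          (ThetaSetting.modelχq_sec2Hyps p 1 2 even_two)).sTheta hη
          ⟨x⁻¹ * g * x, (C.thetaEnvData μ (compat_modelχq p 1 2 even_two)
            (ThetaSetting.modelχq_sec2Hyps p 1 2 even_two)).inv_mul_mul_mem_PiYdd x g⟩)) :
    ¬ ∃ β : MulAut (CycEnvelope
        (C.thetaEnvData μ (compat_modelχq p 1 2 even_two) (ThetaSetting.modelχq_sec2Hyps p 1 2 even_two)).aug
        (C.thetaEnvData μ (compat_modelχq p 1 2 even_two) (ThetaSetting.modelχq_sec2Hyps p 1 2 even_two)).chi),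
      ∀ z : (C.thetaEnvData μ (compat_modelχq p 1 2 even_two) (ThetaSetting.modelχq_sec2Hyps p 1 2 even_two)).env,
        β ⟨z.left, (z.right : (C.thetaEnvData μ (compat_modelχq p 1 2 even_two)
          (ThetaSetting.modelχq_sec2Hyps p 1 2 even_two)).PiX)⟩ =
        ⟨(CycEnvelope.shift hδ z).left, ((CycEnvelope.shift hδ z).right :
          (C.thetaEnvData μ (compat_modelχq p 1 2 even_two) (ThetaSetting.modelχq_sec2Hyps p 1 2 even_two)).PiX)⟩ := by
  rintro ⟨β, hβ⟩
  obtain ⟨ε, hε, hext⟩ := (C.thetaEnvData μ (compat_modelχq p 1 2 even_two)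
    (ThetaSetting.modelχq_sec2Hyps p 1 2 even_two)).exists_cocycle_extension_of_aut_extension
    (centralizer_PiY_trivial_modelTate p C μ) hδ β hβ
  exact not_exists_extension_alphaDelta_modelTate p C μ hN2 hNl x hx hη hδ hshift ⟨ε, hε, hext⟩

end SettingModel

end Literature.AnabelianGeometry.EtaleTheta

end
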